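import Mathlib
import HarnessLib

/-!
# Determinant of a level-`n` endomorphism on an invariant subspace

Family `hodge`, layer `Literature/AlgebraicGeometry/HodgeTheory`. A pure linear-algebra tool for
the step "a level-`n` structure forces special unitary monodromy on the Weil lines" of
van Geemen's account of Weil-type abelian varieties (§§5.8–5.11): if `γ ∈ Γ(n)`, i.e.
`γ = 1 + n D` with `D` an integer matrix, then on every `γ`-invariant complex subspace `E`
(`E` need not be defined over `ℚ`, e.g. an eigenspace of the `K`-action) one has
`det (γ|_E) = 1 + n β` with `β` an algebraic integer (`det_restrict_eq_one_add_mul_of_isIntegral`).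

Proof: over `ℂ` the characteristic polynomial of `γ|_E` splits, so `det (γ|_E)` is the product
of its roots; every root `r` is an eigenvalue of `γ|_E`, hence of `γ = 1 + n D`, so (for `n ≠ 0`)
`(r - 1) / n` is an eigenvalue of `D`, i.e. a root of the characteristic polynomial of the
integer matrix `D`, which is monic with integer coefficients: `r = 1 + n ρ` with `ρ` integral
over `ℤ`. Finally a product of numbers `1 + n ρᵢ` (`ρᵢ` integral) is `1 + n β` with `β` integral
(`multiset_prod_eq_one_add_mul_of_isIntegral`).

## References

* [vanGeemen1994HodgeAV] B. van Geemen, An introduction to the Hodge conjecture for abelian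
  varieties, Algebraic cycles and Hodge theory (Torino 1993), LNM 1594, Springer 1994, 5.8–5.11.
-/

noncomputable section

namespace Literature.AlgebraicGeometry.HodgeTheory

open Module Polynomial

/-- A product of complex numbers of the form `1 + n ρᵢ` with every `ρᵢ` an algebraic integer is
of the form `1 + n β` with `β` an algebraic integer: if `∀ r ∈ s, ∃ ρ, IsIntegral ℤ ρ ∧ r = 1 + n ρ`
then `∃ β, IsIntegral ℤ β ∧ s.prod = 1 + n β` (induction on the multiset `s`, using
`(1 + n ρ) (1 + n β₀) = 1 + n (ρ + β₀ + n ρ β₀)`). [folklore] -/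
theorem multiset_prod_eq_one_add_mul_of_isIntegral (n : ℕ) (s : Multiset ℂ)
    (hs : ∀ r ∈ s, ∃ ρ : ℂ, IsIntegral ℤ ρ ∧ r = 1 + n * ρ) :
    ∃ β : ℂ, IsIntegral ℤ β ∧ s.prod = 1 + n * β := by
  induction s using Multiset.induction_on with
  | empty => exact ⟨0, isIntegral_zero, by simp⟩
  | cons a s ih =>
    obtain ⟨β₀, hβ₀, hs₀⟩ := ih fun r hr => hs r (Multiset.mem_cons_of_mem hr)
    obtain ⟨ρ, hρ, ha⟩ := hs a (Multiset.mem_cons_self a s)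
    refine ⟨ρ + β₀ + n * (ρ * β₀),
      (hρ.add hβ₀).add ((isIntegral_natCast n).mul (hρ.mul hβ₀)), ?_⟩
    rw [Multiset.prod_cons, hs₀, ha]
    ring

variable {V : Type*} [AddCommGroup V] [Module ℂ V] [FiniteDimensional ℂ V]
variable {ι : Type*} [Fintype ι] [DecidableEq ι]

/-- **Level-`n` elements have determinant `≡ 1 (mod n)` on invariant subspaces.** Let `D` be an
endomorphism of a finite-dimensional complex vector space `V` whose matrix in some basis `b` is an
integer matrix `Dℤ`, let `n : ℕ`, and let `E ⊆ V` be a complex subspace invariant under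
`γ = 1 + n D`. Then `det (γ|_E) = 1 + n β` for some `β ∈ ℂ` integral over `ℤ`: the eigenvalues
of `γ|_E` are `1 + n ρ` with `ρ` an eigenvalue of the integer matrix `Dℤ`, hence an algebraic
integer, and `det (γ|_E)` is their product. This is the step "`γ ∈ Γ(n)` ⇒ `det_K γ ≡ 1 mod n`
in the ring of algebraic integers" of the argument that a level-`n` structure (`n ≥ 3`) makes the
monodromy special unitary for the `K`-Hermitian form. [cite: vanGeemen1994HodgeAV, 5.8–5.11] -/
theorem det_restrict_eq_one_add_mul_of_isIntegral (b : Module.Basis ι ℂ V) (D : Module.End ℂ V)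
    (Dℤ : Matrix ι ι ℤ) (hD : LinearMap.toMatrix b b D = Dℤ.map (Int.castRingHom ℂ))
    (n : ℕ) (E : Submodule ℂ V) (hE : ∀ v ∈ E, (1 + (n : ℂ) • D) v ∈ E) :
    ∃ β : ℂ, IsIntegral ℤ β ∧ LinearMap.det ((1 + (n : ℂ) • D).restrict hE) = 1 + n * β := by
  set f : Module.End ℂ E := (1 + (n : ℂ) • D).restrict hE with hf
  rw [Module.End.det_eq_prod_roots_charpoly_of_splits (IsAlgClosed.splits f.charpoly)]
  refine multiset_prod_eq_one_add_mul_of_isIntegral n _ fun r hr => ?_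
  -- `r` is a root of the characteristic polynomial of `f = γ|_E`, hence an eigenvalue of `f`.
  obtain ⟨v, hv⟩ := ((Module.End.hasEigenvalue_iff_isRoot_charpoly f r).mpr
    (Polynomial.isRoot_of_mem_roots hr)).exists_hasEigenvector
  have hv0 : (v : V) ≠ 0 := fun h => hv.2 (Subtype.ext h)
  have key : (v : V) + (n : ℂ) • D v = r • (v : V) := by
    have h := congrArg Subtype.val hv.apply_eq_smul
    simpa [hf, LinearMap.restrict_apply] using h
  rcases eq_or_ne n 0 with rfl | hn
  · -- `n = 0`: `γ = 1`, so `r = 1 = 1 + 0 · 0`.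
    refine ⟨0, isIntegral_zero, ?_⟩
    have h1 : (r - 1) • (v : V) = 0 := by
      rw [sub_smul, one_smul, ← key]
      simp
    have h2 : r - 1 = 0 := (smul_eq_zero.mp h1).resolve_right hv0
    linear_combination h2
  · -- `n ≠ 0`: `(r - 1) / n` is an eigenvalue of `D`, hence a root of `Dℤ.charpoly`.
    refine ⟨(r - 1) / n, ?_, by field_simp; ring⟩
    have hn' : (n : ℂ) ≠ 0 := Nat.cast_ne_zero.mpr hn
    have hDv : D v = ((r - 1) / n) • (v : V) := by
      have h1 : (n : ℂ) • D v = (r - 1) • (v : V) := by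
        rw [sub_smul, one_smul, ← key]
        abel
      have h2 := congrArg ((n : ℂ)⁻¹ • ·) h1
      simp only [smul_smul, inv_mul_cancel₀ hn', one_smul] at h2
      rw [h2, div_eq_inv_mul]
    have hev : D.HasEigenvalue ((r - 1) / n) :=
      Module.End.hasEigenvalue_of_hasEigenvector ⟨Module.End.mem_eigenspace_iff.mpr hDv, hv0⟩
    have hroot := (Module.End.hasEigenvalue_iff_isRoot_charpoly D _).mp hev
    rw [← LinearMap.charpoly_toMatrix D b, hD, Matrix.charpoly_map, Polynomial.IsRoot,
      Polynomial.eval_map] at hroot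
    exact ⟨Dℤ.charpoly, Matrix.charpoly_monic Dℤ, by rwa [algebraMap_int_eq]⟩

end Literature.AlgebraicGeometry.HodgeTheory

end
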